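import Literature.MathematicalPhysics.QuantumFieldTheory.Balaban1983to89.B9Thm39Thm311AtLettersR
import Literature.MathematicalPhysics.QuantumFieldTheory.Balaban1983to89.Node00.OpsYRecordV4P
import Literature.MathematicalPhysics.QuantumFieldTheory.Balaban1983to89.B9Thm315WholeSectERepOn

/-!
# [B9] Rows 17 and 24 of the N06 knit at def-Y's operator layer, RE-PRESSED ONCE AT GENERIC `(R₁, R₂, c)` — STEP 3 twins

Bookkeeping companion of MODULE 3-R (`B9BackgroundsKLevelV1R`: `bg9YR 𝔸 G R₁ R₂ x`, the class axioms `MemOfFam`, `Imp336335` as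
`R`-HYPOTHESES) and MODULE 5-R (`B9PinCarriersKLevelV1R.b9LeafX_carriersYR`), written for dag-n06-d's R-GENERIC certificate (the STEP-3 face
census of 2026-08-28, bus l.39391: «every face pinned at `bg9Y` needs an R-twin»).  Two of def-Y's supplier faces are pinned at MODULE 3's reading
`bg9Y 𝔸 G x` of the cube classes (3.35)–(3.36) and at the literal class constant `c35Y`, although their PROOFS never read the class:

* ROW 24 (`t315`, Theorem 3.15 through the (3.185) slot, middle decay on Λ only): `B9Thm315WholeSectERepOn.thm315FullPrinted_sectE_of_3185_on` ∕
  `t315_opsYSectE_of_3185_on` read the background ONLY through `.Cfg` and hand the two class provisos `hU`, `hU'` to the displayed slot `h`;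
* ROW 17 (`t311`, Theorem 3.11 at the letters): `B9Thm311ReadingAtLetters.t311_of_pins_opsYOfLetters` reads the background only through `.Cfg` and
  hands `hU` to the displayed schema `h311` (`B9Thm311Whole.thm311Printed_of_inputs` is background- and constant-generic, `inputs311_ops311Y` is
  background-free).

So both are CLASS-BLIND (rule (b) of def-Y's RULING LOCATED-STEP3, bus l.38785): the twins below are the SAME proof scripts with the objects and the
provisos typed over `bg9YR 𝔸 G R₁ R₂ x` (whose `.Cfg` is `bg9Y`'s, `rfl`) and the class constant a binder `c`; the site kernel `C^{(k)}` is re-typed by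
MODULE 3-R's `siteKernelR R₁ R₂` (same kernel, `siteKernelR_ker`), exactly the shape of MODULE 5-R's leaf
`t315 : B9.Thm315FullPrinted c35Y geo9Y (bg9YR 𝔸 G R₁ R₂) (fun x => siteKernelR R₁ R₂ (ops x).Ck) inΛY unitDistY (fun x => (ops x).GivenBy3185) (fun x => (ops x).HasRWExpC)`
and `t311 : B9.Thm311Printed c35Y geo9Y (bg9YR 𝔸 G R₁ R₂) (fun x => (ops x).PosDef)` (at `c := c35Y`).

§3 additionally presses dag-n06-d's EDITION-39 discharge of row 17 (certificate `…N06AtOpsYNuOfRecordV6EPairNT`, l.234: the chain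
`inputs311Y_of_five ∘ inputs311Y₅_of_four ∘ inputs311Y₄_of_posDefTr_deltaAY` at the v4P letters of record `lettersYOfRecordV4P` with the proof letters
`proofLettersGA`) once at generic `(R₁, R₂, c)`: there the ONE class read «a configuration in (3.35) is `SU(N)`-valued» (`hU.1.1` at `bg9Y`) becomes the
DISPLAYED class axiom `hG : MemOfFam SU(N) R₁` (rule (c); a theorem at both readings: `memOfFam_regY335`, `memOfFam_regYP335`), and the clause
«Δ_a(U) positive definite on (3.35)» stays the displayed `hΔA` (at `bg9Y` EDITION 39 derives it from the principal coercivity; at print's class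
`B9Eq335CoveragePAtLettersY.posDefTr_deltaAY_member_of_principal_P`; at generic `(R₁, R₂)` it is a hypothesis).  `_P` = the reading at print's class
`bg9YP` (MODULE 3-P, «a number ≧ 10»), by `exact`.

CONSUMER: the R-GENERIC EDITION of dag-n06-d's certificate (objects AND premises over `bg9YR`; today's Y-closer and the future P-closer by `rfl`).
Nothing of `B9Thm311ReadingAtLetters` (dag-n06-j lineage) or `B9Thm315WholeSectERepOn` is edited — append-only twins in a new file.
HONEST SCOPE.  Kernel-typing bookkeeping: the (3.185) slot, the random-walk expansion clause, the outer locality, the middle decay, the schema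
`Inputs311Y`, «Δ_a(U) > 0 on (3.35)» all stay DISPLAYED hypotheses of printed shape; nothing of [B9] is asserted; NOT a node discharge, NOT summit
progress; count-neutral; one finite 𝕋⁴ programme — nothing continuum, nothing about the mass gap.  Cell `pub-ymgap` (HUMAN RULING D-0062), Track A
node N06 [B9], seat `pub-ymgap-node00-def-Y` (gen 23), 2026-08-28.  No `sorry`, no `axiom`, no `instance`, no `notation`, no `def`.
-/

namespace Literature.MathematicalPhysics.QuantumFieldTheory.Balaban1983to89.B9Thm311Thm315FacesAtLettersR

open Literature.MathematicalPhysics.QuantumFieldTheory.Balaban1983to89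
open B9Thm311Whole B9Thm311ReadingCoords B9Thm311ReadingAtLetters B9Thm311SymmAtRecordV4 B9Thm311PosAtRecordV4 Node00
open B6KLevelCensusIndexV1 B9PinMembersKLevelV1 B9PinCarriersKLevelV1 B9PinGeometryKLevelV1 B7Prop2SpecialUnitary
open B9BackgroundsKLevelV1R
open B9Thm315WholeSectERep B9Thm315WholeSectERepOn

noncomputable section

/-! ## §1 Row 24 (Theorem 3.15 through the (3.185) slot, middle decay on Λ only) at generic `(R₁, R₂, c)` -/

section Layer315

variable {d ℓ : ℕ} {hd : 1 ≤ d + 1} {hL : Odd (ℓ + 1) ∧ 1 < ℓ + 1} {b₀ b₁ : ℝ} {Mstar : ℕ}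
variable {𝔸 : Type} [NormedRing 𝔸] [NormedAlgebra ℂ 𝔸] [CompleteSpace 𝔸] [FiniteDimensional ℂ 𝔸] {G : Subgroup 𝔸ˣ}
variable (R₁ R₂ : RegFamY d ℓ hd hL b₀ b₁ Mstar 𝔸)

/-- ★★ **ROW 24 AT THE SECT. E LAYER, RE-PRESSED ONCE AT GENERIC `(R₁, R₂, c)`** (the twin of `B9Thm315WholeSectERepOn.thm315FullPrinted_sectE_of_3185_on`
for every reading of the cube classes and every class constant): from the ONE displayed slot `h` — on `(bg9YR 𝔸 G R₁ R₂ x).Reg335 c α₀ U` (= `R₁ x c α₀ U`)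
and `(bg9YR …).Reg336 c α₀ U` (= `R₂ x c α₀ U`), Mα₀ ≦ a₀: the (3.185) identity, the random-walk expansion clause with rate δ₁, the outer locality
`LocalOuterY r m_E m_F` and the middle decay ON Λ `DecayMidOnY B₁ δ₁` — the full printed Theorem 3.15 over `bg9YR 𝔸 G R₁ R₂` for the Sect. E layer's
`C^{(k)}` (re-typed by `siteKernelR R₁ R₂`, same kernel), with OUTPUT δ₀ = δ₁, a₀, B₀ = B₁e^{2δ₁r}m_Em_F; proof VERBATIM (`bound3187_sectE_of_3185_on`).
NOT a node discharge. [cite: Balaban1985BackgroundPropagators, Thm 3.15 (3.185)–(3.187) p.432, (3.169) p.430, (3.35)–(3.36) p.396] -/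
theorem thm315FullPrinted_sectE_of_3185_onR
    (ops : ∀ x : MemberY d ℓ hd hL b₀ b₁ Mstar, OperatorLayerY d ℓ hd hL b₀ b₁ Mstar 𝔸 G x)
    (𝔏 : ∀ x : MemberY d ℓ hd hL b₀ b₁ Mstar, CovLettersY 𝔸 x) (𝔢 : ∀ x : MemberY d ℓ hd hL b₀ b₁ Mstar, SectELettersY 𝔸 x)
    (𝔴 : ∀ x : MemberY d ℓ hd hL b₀ b₁ Mstar, RWLettersEY 𝔸 G x)
    {c a₀ δ₁ B₁ r mE mF : ℝ} (ha₀ : 0 < a₀) (hδ₁ : 0 < δ₁) (hB₁ : 0 < B₁) (hmE : 0 < mE) (hmF : 0 < mF)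
    (h : ∀ (x : MemberY d ℓ hd hL b₀ b₁ Mstar) (α₀ : ℝ), 0 < α₀ → (geo9Y x).M * α₀ ≤ a₀ →
      ∀ U : (bg9YR 𝔸 G R₁ R₂ x).Cfg, (bg9YR 𝔸 G R₁ R₂ x).Reg335 c α₀ U → (bg9YR 𝔸 G R₁ R₂ x).Reg336 c α₀ U →
        givenBy3185Y x (𝔏 x) (𝔢 x) U ∧ hasRWExpCY (𝔴 x) U δ₁ ∧
          LocalOuterY x (𝔢 x) r mE mF U ∧ DecayMidOnY x (𝔏 x) (𝔢 x) B₁ U δ₁) :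
    B9.Thm315FullPrinted c geo9Y (bg9YR 𝔸 G R₁ R₂)
      (fun x => siteKernelR R₁ R₂ (operatorLayerYSectE 𝔸 G x (ops x) (𝔏 x) (𝔢 x) (𝔴 x)).Ck) inΛY unitDistY
      (fun x => (operatorLayerYSectE 𝔸 G x (ops x) (𝔏 x) (𝔢 x) (𝔴 x)).GivenBy3185)
      (fun x => (operatorLayerYSectE 𝔸 G x (ops x) (𝔏 x) (𝔢 x) (𝔴 x)).HasRWExpC) := by
  refine ⟨δ₁, a₀, B₁ * Real.exp (2 * δ₁ * r) * mE * mF, hδ₁, ha₀, by positivity, fun x α₀ hα hMa U hU hU' => ?_⟩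
  obtain ⟨h85, hRW, hLoc, hS⟩ := h x α₀ hα hMa U hU hU'
  exact ⟨h85, hRW, fun y y' _ _ => bound3187_sectE_of_3185_on hB₁.le hδ₁.le h85 hLoc hS y y'⟩

end Layer315

section Record315

open scoped Matrix.Norms.L2Operator

variable (N : ℕ) (θ : Stage3Params) (Mstar : ℕ)
variable (R₁ R₂ : RegFamY θ.d₆ θ.ℓ₆ θ.hd' θ.hL' θ.b₀ θ.b₁ Mstar (Matrix (Fin N) (Fin N) ℂ))

/-- ★★ **ROW 24 (`t315`) AT THE SECT. E LAYER FAMILY `opsYSectE N θ M⋆ ops 𝔏 𝔢 𝔴`, RE-PRESSED ONCE AT GENERIC `(R₁, R₂, c)`** (the twin of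
`B9Thm315WholeSectERepOn.t315_opsYSectE_of_3185_on`; generic base family and letters): exactly MODULE 5-R's leaf
`t315 : B9.Thm315FullPrinted c35Y geo9Y (bg9YR … R₁ R₂) (fun x => siteKernelR R₁ R₂ (ops x).Ck) inΛY unitDistY (fun x => (ops x).GivenBy3185) (fun x => (ops x).HasRWExpC)`
at `ops := opsYSectE …`, `c := c35Y`. [cite: Balaban1985BackgroundPropagators, Thm 3.15 (3.185)–(3.187) p.432, (3.35)–(3.36) p.396] -/
theorem t315_opsYSectE_of_3185_onR (ops : OpsY N θ Mstar) (𝔏 : LettersY N θ Mstar) (𝔢 : SectEY N θ Mstar) (𝔴 : RWEY N θ Mstar)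
    {c a₀ δ₁ B₁ r mE mF : ℝ} (ha₀ : 0 < a₀) (hδ₁ : 0 < δ₁) (hB₁ : 0 < B₁) (hmE : 0 < mE) (hmF : 0 < mF)
    (h : ∀ (x : MemberY θ.d₆ θ.ℓ₆ θ.hd' θ.hL' θ.b₀ θ.b₁ Mstar) (α₀ : ℝ), 0 < α₀ → (geo9Y x).M * α₀ ≤ a₀ →
      ∀ U : (bg9YR (Matrix (Fin N) (Fin N) ℂ) (specialUnitaryUnits (Fin N)) R₁ R₂ x).Cfg,
        (bg9YR (Matrix (Fin N) (Fin N) ℂ) (specialUnitaryUnits (Fin N)) R₁ R₂ x).Reg335 c α₀ U →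
        (bg9YR (Matrix (Fin N) (Fin N) ℂ) (specialUnitaryUnits (Fin N)) R₁ R₂ x).Reg336 c α₀ U →
          givenBy3185Y x (𝔏 x) (𝔢 x) U ∧ hasRWExpCY (𝔴 x) U δ₁ ∧
            LocalOuterY x (𝔢 x) r mE mF U ∧ DecayMidOnY x (𝔏 x) (𝔢 x) B₁ U δ₁) :
    B9.Thm315FullPrinted c geo9Y (bg9YR (Matrix (Fin N) (Fin N) ℂ) (specialUnitaryUnits (Fin N)) R₁ R₂)
      (fun x => siteKernelR R₁ R₂ (opsYSectE N θ Mstar ops 𝔏 𝔢 𝔴 x).Ck) inΛY unitDistY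
      (fun x => (opsYSectE N θ Mstar ops 𝔏 𝔢 𝔴 x).GivenBy3185) (fun x => (opsYSectE N θ Mstar ops 𝔏 𝔢 𝔴 x).HasRWExpC) :=
  thm315FullPrinted_sectE_of_3185_onR R₁ R₂ ops 𝔏 𝔢 𝔴 ha₀ hδ₁ hB₁ hmE hmF h

end Record315

/-! ## §2 Row 17 (Theorem 3.11 at the letters) at generic `(R₁, R₂, c)` -/

section Row17

open scoped Matrix.Norms.L2Operator

variable {N : ℕ} (θ : Stage3Params) (Mstar : ℕ) (𝔏 : LettersY N θ Mstar) (𝔈 : ExpsY N θ Mstar)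
variable (R₁ R₂ : RegFamY θ.d₆ θ.ℓ₆ θ.hd' θ.hL' θ.b₀ θ.b₁ Mstar (Matrix (Fin N) (Fin N) ℂ))

/-- ★★ **ROW 17 OF THE N06 KNIT AT def-Y's OPERATOR LAYER `opsYOfLetters N θ M⋆ 𝔏 𝔈` WITH THE LETTERS PINNED, RE-PRESSED ONCE AT GENERIC `(R₁, R₂, c)`**
(the twin of `B9Thm311ReadingAtLetters.t311_of_pins_opsYOfLetters` for every reading of the cube class and every class constant): for every letters
family `𝔏` with `Gp` ∕ `GA` pinned to def-Y's `GpY` ∕ `GAY` (`hGp`, `hGA`), free proof letters `𝔔` and expansion letters `𝔈` with the positivity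
field pinned to the genuine reading (`hPD`), the ONE displayed schema `Inputs311Y` under the provisos M ≧ M₁, 0 < α₀, Mα₀ ≦ a₁ and
`(bg9YR … R₁ R₂ x).Reg335 c α₀ U` (= `R₁ x c α₀ U`) yields `B9.Thm311Printed c geo9Y (bg9YR … R₁ R₂) (fun x => (opsYOfLetters … x).PosDef)` — MODULE 5-R's
`t311` leaf at `c := c35Y`.  Printed quantifiers met with M₃ := max M₁ 2θ₁, a₀ := a₁; per member `inputs311_ops311Y` → `posDefOfOps_all` verbatim.
[cite: Balaban1985BackgroundPropagators, Thm 3.11 p.416 + (3.24)–(3.27) pp.394–395 + (3.35) p.396; Balaban1984PropagatorsI, p.25] -/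
theorem t311_of_pins_opsYOfLettersR (𝔔 : ∀ x : MemberY θ.d₆ θ.ℓ₆ θ.hd' θ.hL' θ.b₀ θ.b₁ Mstar, ProofLetters311 N x.toKIdx)
    (c θ₁ a₁ M₁ : ℝ) (ha₁ : 0 < a₁) (hM₁ : 0 < M₁)
    (hGp : ∀ x : MemberY θ.d₆ θ.ℓ₆ θ.hd' θ.hL' θ.b₀ θ.b₁ Mstar, (𝔏 x).Gp = GpY x.toKIdx (𝔏 x).parS)
    (hGA : ∀ x : MemberY θ.d₆ θ.ℓ₆ θ.hd' θ.hL' θ.b₀ θ.b₁ Mstar, (𝔏 x).GA = GAY x.toKIdx (𝔏 x).parS (𝔏 x).parB (𝔏 x).Gp)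
    (h311 : ∀ x : MemberY θ.d₆ θ.ℓ₆ θ.hd' θ.hL' θ.b₀ θ.b₁ Mstar, M₁ ≤ (geo9Y x).M → ∀ α₀ : ℝ, 0 < α₀ → (geo9Y x).M * α₀ ≤ a₁ →
      ∀ U : (bg9YR (Matrix (Fin N) (Fin N) ℂ) (specialUnitaryUnits (Fin N)) R₁ R₂ x).Cfg,
        (bg9YR (Matrix (Fin N) (Fin N) ℂ) (specialUnitaryUnits (Fin N)) R₁ R₂ x).Reg335 c α₀ U →
          Inputs311Y x (𝔏 x) (𝔔 x) θ₁ (geo9Y x).M U)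
    (hPD : ∀ x : MemberY θ.d₆ θ.ℓ₆ θ.hd' θ.hL' θ.b₀ θ.b₁ Mstar,
      ((opsYOfLetters N θ Mstar 𝔏 𝔈) x).PosDef = PosDefOfOps (ops311Y x (𝔏 x) (𝔔 x))) :
    B9.Thm311Printed c geo9Y (bg9YR (Matrix (Fin N) (Fin N) ℂ) (specialUnitaryUnits (Fin N)) R₁ R₂)
      (fun x => ((opsYOfLetters N θ Mstar 𝔏 𝔈) x).PosDef) := by
  refine ⟨max M₁ (2 * θ₁), a₁, lt_max_of_lt_left hM₁, ha₁, fun x hM α₀ hα₀ hMa U hU n => ?_⟩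
  have hM₁x : M₁ ≤ (geo9Y x).M := le_trans (le_max_left _ _) hM
  have hMpos : 0 < (geo9Y x).M := lt_of_lt_of_le hM₁ hM₁x
  have hI : Inputs311 (ops311Y x (𝔏 x) (𝔔 x)) θ₁ (geo9Y x).M U :=
    inputs311_ops311Y (hGp x) (hGA x) (h311 x hM₁x α₀ hα₀ hMa U hU)
  have hgoal : PosDefOfOps (ops311Y x (𝔏 x) (𝔔 x)) n U :=
    posDefOfOps_all _ hMpos (le_trans (le_max_right _ _) hM) hI n
  have hPDx := congrFun (congrFun (hPD x) n) U
  exact Eq.mpr hPDx hgoal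

end Row17

/-! ## §3 Row 17 at the v4P letters of record: EDITION 39's discharge chain pressed once at generic `(R₁, R₂, c)` -/

section Row17V4P

open scoped Matrix.Norms.L2Operator

variable {N : ℕ} (θ : Stage3Params) (Mstar : ℕ) (𝔯 : ResY N θ Mstar) (𝔈 : ExpsY N θ Mstar)
variable (R₁ R₂ : RegFamY θ.d₆ θ.ℓ₆ θ.hd' θ.hL' θ.b₀ θ.b₁ Mstar (Matrix (Fin N) (Fin N) ℂ))

/-- ★★ **ROW 17 AT def-Y's v4P LETTERS OF RECORD, RE-PRESSED ONCE AT GENERIC `(R₁, R₂, c)`** — dag-n06-d's EDITION-39 discharge of row 17 (certificate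
`…N06AtOpsYNuOfRecordV6EPairNT` l.234) with its ONE class read displayed: from the pin `hPD` (VERBATIM: the positivity field of `opsYOfLetters … (lettersYOfRecordV4P …) 𝔈`
read at the proof letters `proofLettersGA`), the class axiom `hG : MemOfFam SU(N) R₁` («a configuration in the class is `SU(N)`-valued» — what the chain
reads for (3.24) and the (3.13) adjointness; at `bg9Y` this was `hU.1.1`) and the ONE displayed clause `hΔA` («Δ_a(U) positive definite» under
M ≧ M₁, 0 < α₀, Mα₀ ≦ a₁, `(bg9YR … R₁ R₂ x).Reg335 c α₀ U`): `B9.Thm311Printed c geo9Y (bg9YR … R₁ R₂) (fun x => ((opsYOfLetters N θ M⋆ (lettersYOfRecordV4P N θ M⋆ 𝔯) 𝔈) x).PosDef)`.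
The chain `inputs311Y₄_of_posDefTr_deltaAY` → `inputs311Y₅_of_four` → `inputs311Y_of_five` runs verbatim with `hU.1.1 ↦ mem_of_reg335R hG x hU`, θ₁ := 0,
into §2's `t311_of_pins_opsYOfLettersR` (pins `hGp`, `hGA` by `rfl` at the v4P letters). [cite: Balaban1985BackgroundPropagators, Thm 3.11 p.416 + (3.24)–(3.27) pp.394–395 + (3.35) p.396; Balaban1984PropagatorsI, p.25] -/
theorem t311_of_pins_opsYOfLettersV4P_R
    (hG : MemOfFam (specialUnitaryUnits (Fin N)) R₁) (c a₁ M₁ : ℝ) (ha₁ : 0 < a₁) (hM₁ : 0 < M₁)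
    (hΔA : ∀ x : MemberY θ.d₆ θ.ℓ₆ θ.hd' θ.hL' θ.b₀ θ.b₁ Mstar, M₁ ≤ (geo9Y x).M → ∀ α₀ : ℝ, 0 < α₀ → (geo9Y x).M * α₀ ≤ a₁ →
      ∀ U : (bg9YR (Matrix (Fin N) (Fin N) ℂ) (specialUnitaryUnits (Fin N)) R₁ R₂ x).Cfg,
        (bg9YR (Matrix (Fin N) (Fin N) ℂ) (specialUnitaryUnits (Fin N)) R₁ R₂ x).Reg335 c α₀ U →
          PosDefTr (fun _ => (1 : ℝ))
            (deltaAY x.toKIdx (parSymY x.toKIdx) (parBY x.toKIdx) (GpY x.toKIdx (parSymY x.toKIdx)) U))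
    (hPD : ∀ x : MemberY θ.d₆ θ.ℓ₆ θ.hd' θ.hL' θ.b₀ θ.b₁ Mstar,
      ((opsYOfLetters N θ Mstar (lettersYOfRecordV4P N θ Mstar 𝔯) 𝔈) x).PosDef
        = PosDefOfOps (ops311Y x (lettersYOfRecordV4P N θ Mstar 𝔯 x) (proofLettersGA (lettersYOfRecordV4P N θ Mstar 𝔯 x)))) :
    B9.Thm311Printed c geo9Y (bg9YR (Matrix (Fin N) (Fin N) ℂ) (specialUnitaryUnits (Fin N)) R₁ R₂)
      (fun x => ((opsYOfLetters N θ Mstar (lettersYOfRecordV4P N θ Mstar 𝔯) 𝔈) x).PosDef) :=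
  t311_of_pins_opsYOfLettersR θ Mstar (lettersYOfRecordV4P N θ Mstar 𝔯) 𝔈 R₁ R₂
    (fun x => proofLettersGA (lettersYOfRecordV4P N θ Mstar 𝔯 x)) c 0 a₁ M₁ ha₁ hM₁ (fun _ => rfl) (fun _ => rfl)
    (fun x hM α₀ hα₀ hMa U hU =>
      inputs311Y_of_five specialUnitaryUnits_le_unitaryUnits x (lettersYOfRecordV4P N θ Mstar 𝔯 x) _ rfl rfl rfl rfl
        (mem_of_reg335R hG x hU)
        (inputs311Y₅_of_four specialUnitaryUnits_le_unitaryUnits x (lettersYOfRecordV4P N θ Mstar 𝔯 x) _ rfl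
          (mem_of_reg335R hG x hU)
          (inputs311Y₄_of_posDefTr_deltaAY x (lettersYOfRecordV4P N θ Mstar 𝔯 x) rfl le_rfl (hM₁.le.trans hM)
            (hΔA x hM α₀ hα₀ hMa U hU))))
    hPD

/-- ★ **ROW 17 AT def-Y's v4P LETTERS OF RECORD OVER PRINT's CLASS** (`bg9YP`, MODULE 3-P, «a number ≧ 10»): at `(R₁, R₂) := (regYP335, regYP336)`
(`bg9YP_eq_bg9YR`, `memOfFam_regYP335`) the class-parametric face reads row 17 over print's cube class, by `exact`; there `hΔA` follows from the principal
coercivity alone (`B9Eq335CoveragePAtLettersY.posDefTr_deltaAY_member_of_principal_P`).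
[cite: Balaban1985BackgroundPropagators, Thm 3.11 p.416 + (3.35) p.396 («a number ≧ 10»; bookkeeping)] -/
theorem t311_of_pins_opsYOfLettersV4P_P (c a₁ M₁ : ℝ) (ha₁ : 0 < a₁) (hM₁ : 0 < M₁)
    (hΔA : ∀ x : MemberY θ.d₆ θ.ℓ₆ θ.hd' θ.hL' θ.b₀ θ.b₁ Mstar, M₁ ≤ (geo9Y x).M → ∀ α₀ : ℝ, 0 < α₀ → (geo9Y x).M * α₀ ≤ a₁ →
      ∀ U : (B9BackgroundsKLevelV1P.bg9YP (Matrix (Fin N) (Fin N) ℂ) (specialUnitaryUnits (Fin N)) x).Cfg,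
        (B9BackgroundsKLevelV1P.bg9YP (Matrix (Fin N) (Fin N) ℂ) (specialUnitaryUnits (Fin N)) x).Reg335 c α₀ U →
          PosDefTr (fun _ => (1 : ℝ))
            (deltaAY x.toKIdx (parSymY x.toKIdx) (parBY x.toKIdx) (GpY x.toKIdx (parSymY x.toKIdx)) U))
    (hPD : ∀ x : MemberY θ.d₆ θ.ℓ₆ θ.hd' θ.hL' θ.b₀ θ.b₁ Mstar,
      ((opsYOfLetters N θ Mstar (lettersYOfRecordV4P N θ Mstar 𝔯) 𝔈) x).PosDef
        = PosDefOfOps (ops311Y x (lettersYOfRecordV4P N θ Mstar 𝔯 x) (proofLettersGA (lettersYOfRecordV4P N θ Mstar 𝔯 x)))) :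
    B9.Thm311Printed c geo9Y (B9BackgroundsKLevelV1P.bg9YP (Matrix (Fin N) (Fin N) ℂ) (specialUnitaryUnits (Fin N)))
      (fun x => ((opsYOfLetters N θ Mstar (lettersYOfRecordV4P N θ Mstar 𝔯) 𝔈) x).PosDef) :=
  t311_of_pins_opsYOfLettersV4P_R θ Mstar 𝔯 𝔈
    (regYP335 (Matrix (Fin N) (Fin N) ℂ) (specialUnitaryUnits (Fin N))) (regYP336 (Matrix (Fin N) (Fin N) ℂ) (specialUnitaryUnits (Fin N)))
    memOfFam_regYP335 c a₁ M₁ ha₁ hM₁ hΔA hPD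

end Row17V4P

end

end Literature.MathematicalPhysics.QuantumFieldTheory.Balaban1983to89.B9Thm311Thm315FacesAtLettersR
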